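import Mathlib
import HarnessLib
import Summits.CriticalPhenomena.PercolationContinuityZ3.Theorems.PercNearOneGluingNoHeavyLowerTailKnQuestion8AntitheticRoutingDefs
import Summits.CriticalPhenomena.PercolationContinuityZ3.Theorems.PercNearOneGluingNoHeavyLowerTailKnQuestion8AntitheticRoutingInduction

/-!
# `NoHeavyLowerTail` (crux stmt-CriticalPhenomena-4575), antithetic vdBHK programme: the assembly step P2 of PROOF-RL-g43 —
# (♮) ⟹ RL₁ (Φ-dominance) for the two-level poset of a leg structure, and RL₁ for EVERY generated leg structure

Support file (seat `prim-ineq-gen-7` gen 44; `--supports stmt-CriticalPhenomena-4575`).  No `sorry`, no definitions.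
Memos: run/shared/lean/prim/prim-ineq-gen-7/PROOF-RL-g43.md (P2, P5), REFEREE-RL-g44.md.

SETTING (`…AntitheticRoutingDefs`).  An abstract leg structure `S : AntitheticLegStr Λ` describes the colouring poset `F_v(f+E)` of a leg as the
TWO-LEVEL poset on `Λ ⊕ Λ`: bottoms `inl ρ = b_ρ` (root edge red) ordered by `S.ble`, tops `inr σ = t_σ` (root edge blue) ordered by `S.tle`,
`b_ρ < t_σ ⟺ S.blt ρ σ`, never `t ≤ b`; the map `Φ` of the programme acts by `Φ(b_ρ) = t_{S.Φ ρ}`, `Φ(t_σ) = b_σ` (PROOF-RL P1′).  The routing lemma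
in its weakest (and sufficient) form RL₁ = Φ-DOMINANCE says: for every up-set `R` and down-set `D`, `|R ∩ D| ≤ #{h ∈ D : Φ(h) ∈ R}`.
* `AntitheticLegStr.rl1_of_natural` — **P2**: if `S` satisfies (♮) (`S.Natural`), `S.Φ` is bijective and `b_ρ < Φ(b_ρ)` for all `ρ`, then RL₁ holds —
  for all `R, D ⊆ Λ ⊕ Λ` with `R` closed upward under `b_ρ < t_σ` and `D` closed downward under the three order relations.  (Only these closure
  properties of `R`, `D` are used; transitivity is not needed.)  Proof = the bijection `χ : D → Φ(D)` of PROOF-RL P2 written as an injection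
  `R ∩ D → {h ∈ D : Φ h ∈ R}`: `t_σ ↦ b_{Φ⁻¹σ}`, `b_σ ↦ t_σ` for `t_σ ∈ D`, `b_ρ ↦ b_{Mρ}` otherwise, with `M` the matching given by (♮) at `F* = D_b`.
* `AntitheticLegStr.bijective_hub_Φ`, `bijective_neck_Φ`, `AntitheticForestShape.bijective_strOf_Φ` — `Φ` stays bijective under the constructors.
* `AntitheticForestShape.rl1_strOf` — **RL₁ for EVERY leg structure generated from the 2-chain by HUBs and NECKs** (P2 + `natural_strOf` +
  `inv_strOf`).  With `rl_product` (p392949) and `typed_point` (p392801) this completes the kernel part of PROOF-RL: only the modelling dictionary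
  P1/P1″ (that `strOf` IS the coordinate structure of `F_v(f+E)`; machine-checked on all legs ≤ 8 edges, REFEREE-RL-g44) stays outside Lean.
-/

namespace Summit.CriticalPhenomena.PercolationContinuityZ3.Theorems

open Finset

namespace AntitheticLegStr

variable {Λ : Type*} [Fintype Λ] [DecidableEq Λ]

/-- **PROOF-RL-g43 P2: (♮) ⟹ RL₁ (Φ-dominance).**  For a leg structure satisfying (♮) with bijective `Φ` and the lift `b_ρ < Φ(b_ρ)`: for every
`R ⊆ Λ ⊕ Λ` closed upward under `b_ρ < t_σ` and every `D` closed downward under the bottom order, the top order and `b_ρ < t_σ`,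
`|R ∩ D| ≤ #{h ∈ D : Φ(h) ∈ R}` where `Φ(inl ρ) = inr (S.Φ ρ)` and `Φ(inr σ) = inl σ`. [this work] -/
theorem rl1_of_natural (S : AntitheticLegStr Λ) (hN : S.Natural) (hΦ : Function.Bijective S.Φ)
    (hlift : ∀ ρ, S.blt ρ (S.Φ ρ)) (R D : Finset (Λ ⊕ Λ))
    (hRbt : ∀ ρ σ, S.blt ρ σ → (Sum.inl ρ : Λ ⊕ Λ) ∈ R → (Sum.inr σ : Λ ⊕ Λ) ∈ R)
    (hDb : ∀ ρ ρ', S.ble ρ' ρ → (Sum.inl ρ : Λ ⊕ Λ) ∈ D → (Sum.inl ρ' : Λ ⊕ Λ) ∈ D)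
    (hDt : ∀ σ σ', S.tle σ' σ → (Sum.inr σ : Λ ⊕ Λ) ∈ D → (Sum.inr σ' : Λ ⊕ Λ) ∈ D)
    (hDbt : ∀ ρ σ, S.blt ρ σ → (Sum.inr σ : Λ ⊕ Λ) ∈ D → (Sum.inl ρ : Λ ⊕ Λ) ∈ D) :
    (R ∩ D).card ≤
      (D.filter (fun h => Sum.elim (fun ρ => (Sum.inr (S.Φ ρ) : Λ ⊕ Λ)) (fun σ => (Sum.inl σ : Λ ⊕ Λ)) h ∈ R)).card := by
  classical
  -- the bottom and top parts of `D`
  set Db : Finset Λ := Finset.univ.filter (fun ρ => (Sum.inl ρ : Λ ⊕ Λ) ∈ D) with hDb_def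
  set Dt : Finset Λ := Finset.univ.filter (fun σ => (Sum.inr σ : Λ ⊕ Λ) ∈ D) with hDt_def
  have memDb : ∀ ρ, ρ ∈ Db ↔ (Sum.inl ρ : Λ ⊕ Λ) ∈ D := by
    intro ρ; simp [hDb_def]
  have memDt : ∀ σ, σ ∈ Dt ↔ (Sum.inr σ : Λ ⊕ Λ) ∈ D := by
    intro σ; simp [hDt_def]
  -- the matching from (♮) with `F* = Db`
  obtain ⟨M, hM1, hM2, -, -⟩ := hN Db Dt Db
    (by intro ρ ρ' h hρ; rw [memDb] at hρ ⊢; exact hDb ρ ρ' h hρ)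
    (by intro σ σ' h hσ; rw [memDt] at hσ ⊢; exact hDt σ σ' h hσ)
    (by intro ρ σ h hσ; rw [memDb]; rw [memDt] at hσ; exact hDbt ρ σ h hσ)
    (by intro ρ ρ' h hρ; rw [memDb] at hρ ⊢; exact hDb ρ ρ' h hρ)
    (by intro ρ σ hσ h; rw [memDb]; rw [memDt] at hσ; exact hDbt ρ σ h hσ)
    (Finset.Subset.refl _)
  -- an inverse of `Φ`
  obtain ⟨g, hg1, hg2⟩ := Function.bijective_iff_has_inverse.mp hΦ
  -- the injection `ψ : R ∩ D → {h ∈ D : Φ h ∈ R}`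
  let ψ : Λ ⊕ Λ → Λ ⊕ Λ :=
    Sum.elim (fun ρ => if (Sum.inr ρ : Λ ⊕ Λ) ∈ D then (Sum.inr ρ : Λ ⊕ Λ) else Sum.inl (M ρ))
      (fun σ => (Sum.inl (g σ) : Λ ⊕ Λ))
  refine Finset.card_le_card_of_injOn ψ ?_ ?_
  · -- maps `R ∩ D` into `{h ∈ D : Φ h ∈ R}`
    intro d hd
    have hd' : d ∈ R ∧ d ∈ D := by simpa using hd
    rcases d with ρ | σ
    · by_cases h : (Sum.inr ρ : Λ ⊕ Λ) ∈ D
      · have : ψ (Sum.inl ρ) = Sum.inr ρ := by simp [ψ, h]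
        rw [Finset.mem_coe, this, Finset.mem_filter]
        exact ⟨h, by simpa using hd'.1⟩
      · have hA := hM1 ρ ((memDb ρ).2 hd'.2) (by rw [memDt]; exact h)
        have : ψ (Sum.inl ρ) = Sum.inl (M ρ) := by simp [ψ, h]
        rw [Finset.mem_coe, this, Finset.mem_filter]
        exact ⟨(memDb _).1 hA.1, by simpa using hRbt ρ _ hA.2.2 hd'.1⟩
    · have : ψ (Sum.inr σ) = Sum.inl (g σ) := by simp [ψ]
      rw [Finset.mem_coe, this, Finset.mem_filter]
      refine ⟨hDbt (g σ) σ ?_ hd'.2, ?_⟩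
      · have := hlift (g σ); rwa [hg2 σ] at this
      · simpa [hg2 σ] using hd'.1
  · -- injective on `R ∩ D`
    intro d₁ hd₁ d₂ hd₂ heq
    have hd₁' : d₁ ∈ R ∧ d₁ ∈ D := by simpa using hd₁
    have hd₂' : d₂ ∈ R ∧ d₂ ∈ D := by simpa using hd₂
    rcases d₁ with ρ₁ | σ₁ <;> rcases d₂ with ρ₂ | σ₂
    · by_cases h₁ : (Sum.inr ρ₁ : Λ ⊕ Λ) ∈ D <;> by_cases h₂ : (Sum.inr ρ₂ : Λ ⊕ Λ) ∈ D
      · have e : (Sum.inr ρ₁ : Λ ⊕ Λ) = Sum.inr ρ₂ := by simpa [ψ, h₁, h₂] using heq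
        rw [Sum.inr.injEq] at e; rw [e]
      · simp [ψ, h₁, h₂] at heq
      · simp [ψ, h₁, h₂] at heq
      · have e : (Sum.inl (M ρ₁) : Λ ⊕ Λ) = Sum.inl (M ρ₂) := by simpa [ψ, h₁, h₂] using heq
        rw [Sum.inl.injEq] at e
        have := hM2 ρ₁ ρ₂ ((memDb _).2 hd₁'.2) (by rw [memDt]; exact h₁) ((memDb _).2 hd₂'.2) (by rw [memDt]; exact h₂) e
        rw [this]
    · by_cases h₁ : (Sum.inr ρ₁ : Λ ⊕ Λ) ∈ D
      · simp [ψ, h₁] at heq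
      · have e : (Sum.inl (M ρ₁) : Λ ⊕ Λ) = Sum.inl (g σ₂) := by simpa [ψ, h₁] using heq
        rw [Sum.inl.injEq] at e
        have hA := hM1 ρ₁ ((memDb ρ₁).2 hd₁'.2) (by rw [memDt]; exact h₁)
        have : S.Φ (M ρ₁) ∈ Dt := by rw [e, hg2 σ₂, memDt]; exact hd₂'.2
        exact absurd this hA.2.1
    · by_cases h₂ : (Sum.inr ρ₂ : Λ ⊕ Λ) ∈ D
      · simp [ψ, h₂] at heq
      · have e : (Sum.inl (g σ₁) : Λ ⊕ Λ) = Sum.inl (M ρ₂) := by simpa [ψ, h₂] using heq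
        rw [Sum.inl.injEq] at e
        have hA := hM1 ρ₂ ((memDb ρ₂).2 hd₂'.2) (by rw [memDt]; exact h₂)
        have : S.Φ (M ρ₂) ∈ Dt := by rw [← e, hg2 σ₁, memDt]; exact hd₁'.2
        exact absurd this hA.2.1
    · have e : (Sum.inl (g σ₁) : Λ ⊕ Λ) = Sum.inl (g σ₂) := by simpa [ψ] using heq
      rw [Sum.inl.injEq] at e
      have : σ₁ = σ₂ := by rw [← hg2 σ₁, ← hg2 σ₂, e]
      rw [this]

omit [Fintype Λ] [DecidableEq Λ] in
/-- `Φ` of the HUB of a structure with bijective `Φ` is bijective. [this work] -/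
theorem bijective_hub_Φ (S : AntitheticLegStr Λ) (h : Function.Bijective S.Φ) : Function.Bijective (hub S).Φ := by
  obtain ⟨g, hg1, hg2⟩ := Function.bijective_iff_has_inverse.mp h
  refine Function.bijective_iff_has_inverse.mpr ⟨fun p => if p.1 = true then (false, p.2) else (true, g p.2), ?_, ?_⟩
  · rintro ⟨c, x⟩; cases c <;> simp [hub, hg1 x]
  · rintro ⟨c, x⟩; cases c <;> simp [hub, hg2 x]

omit [Fintype Λ] [DecidableEq Λ] in
/-- `Φ` of the NECK of two structures with bijective `Φ` is bijective. [this work] -/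
theorem bijective_neck_Φ {Λ₂ : Type*} (S₁ : AntitheticLegStr Λ) (S₂ : AntitheticLegStr Λ₂)
    (h₁ : Function.Bijective S₁.Φ) (h₂ : Function.Bijective S₂.Φ) : Function.Bijective (neck S₁ S₂).Φ := by
  obtain ⟨g₁, hg₁, hg₁'⟩ := Function.bijective_iff_has_inverse.mp h₁
  obtain ⟨g₂, hg₂, hg₂'⟩ := Function.bijective_iff_has_inverse.mp h₂
  refine Function.bijective_iff_has_inverse.mpr ⟨fun p => (g₁ p.1, g₂ p.2), ?_, ?_⟩
  · rintro ⟨x, y⟩; simp [neck, hg₁ x, hg₂ y]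
  · rintro ⟨x, y⟩; simp [neck, hg₁' x, hg₂' y]

end AntitheticLegStr

namespace AntitheticForestShape

/-- `Φ` of every generated leg structure is bijective (PROOF-RL P1′: `Φ′` is a bijection of `2^E`). [this work] -/
theorem bijective_strOf_Φ : ∀ F : AntitheticForestShape, Function.Bijective (strOf F).Φ
  | nil => by
      refine Function.bijective_iff_has_inverse.mpr ⟨fun u => u, ?_, ?_⟩ <;> intro u <;> rfl
  | cons s r => AntitheticLegStr.bijective_neck_Φ _ _ (AntitheticLegStr.bijective_hub_Φ _ (bijective_strOf_Φ s)) (bijective_strOf_Φ r)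

/-- **RL₁ (Φ-DOMINANCE) FOR EVERY GENERATED LEG STRUCTURE (PROOF-RL-g43 P2 + P5).**  For every forest shape `F`, in the two-level poset of
`strOf F`: for every `R` closed upward under `b_ρ < t_σ` and every `D` closed downward under the bottom order, the top order and `b_ρ < t_σ`,
`|R ∩ D| ≤ #{h ∈ D : Φ(h) ∈ R}`. [this work] -/
theorem rl1_strOf (F : AntitheticForestShape) (R D : Finset (labelType F ⊕ labelType F))
    (hRbt : ∀ ρ σ, (strOf F).blt ρ σ → (Sum.inl ρ : labelType F ⊕ labelType F) ∈ R → (Sum.inr σ : labelType F ⊕ labelType F) ∈ R)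
    (hDb : ∀ ρ ρ', (strOf F).ble ρ' ρ → (Sum.inl ρ : labelType F ⊕ labelType F) ∈ D → (Sum.inl ρ' : labelType F ⊕ labelType F) ∈ D)
    (hDt : ∀ σ σ', (strOf F).tle σ' σ → (Sum.inr σ : labelType F ⊕ labelType F) ∈ D → (Sum.inr σ' : labelType F ⊕ labelType F) ∈ D)
    (hDbt : ∀ ρ σ, (strOf F).blt ρ σ → (Sum.inr σ : labelType F ⊕ labelType F) ∈ D → (Sum.inl ρ : labelType F ⊕ labelType F) ∈ D) :
    (R ∩ D).card ≤
      (D.filter (fun h => Sum.elim (fun ρ => (Sum.inr ((strOf F).Φ ρ) : labelType F ⊕ labelType F))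
        (fun σ => (Sum.inl σ : labelType F ⊕ labelType F)) h ∈ R)).card := by
  obtain ⟨-, -, -, -, h5⟩ := inv_strOf F
  exact AntitheticLegStr.rl1_of_natural (strOf F) (natural_strOf F) (bijective_strOf_Φ F) h5 R D hRbt hDb hDt hDbt

end AntitheticForestShape

end Summit.CriticalPhenomena.PercolationContinuityZ3.Theorems
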